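import Summits.FinalStateConjecture.FinalStateConjecture.Theorems.EIHFluxBalanceInertialRecessionStubHigherOrderRStepPoint

/-!
# Route EIHFluxBalance — `InertialRecession` (E′), line `SketchCleanExcision`, skeleton r13,
# stub `stub_higherOrderSlaving` (EF): jet bookkeeping for the third-order step

Helper file for the crux `stmt-FinalStateConjecture-17403`
(`Summit.FinalStateConjecture.FinalStateConjecture.Theses.EIHFluxBalance.InertialRecession`, E′),
registered stub `stub_higherOrderSlaving` (orders two and three of frozen-vacuum slaving); seat 1's
part of the lead's stub-offer `higherOrder_c3step_point` (order-three twin of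
`higherOrder_rstep_point`, `…StubHigherOrderRStepPoint`).

`higherOrder_c3step_jets`: pure operator-norm bookkeeping. At a slice point the `3`-jet of the
frozen ansatz `g₀` is the `3`-jet of the frozen field `G₀` plus the slice combinations of `dx⁰` with
the variation fields `P₁, P₂, P₃` (`higherOrder_sliceModel`, here hypotheses `h1`–`h3` on the jets as
multilinear maps); removing the pure cube `(y⁰v⁰w⁰) P₃` (the `3`-jet of `G₂ = g₀ − ⅙(x⁰−t)³P₃`,
hypothesis `hE`) and given the bounds of `higherOrder_jetBounds` (frozen jets `≤ C`, frozen minus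
own summand `≤ β`, first variation `≤ σ₁`, second `≤ σ₂`, third `≤ σ₃`), the jets of `g₀`, of `G₂`
and their distances to the jets `K₁, K₂, K₃` of the own summand obey the seven linear bounds used by
the third-order step.

No definitions, no named facts, no `sorry`.
-/

set_option linter.dupNamespace false
set_option maxSynthPendingDepth 6
set_option synthInstance.maxHeartbeats 200000

noncomputable section

namespace Summit.FinalStateConjecture.FinalStateConjecture.Theorems.SublinearIsFree.Slaving

open scoped Topology ContDiff
open Filter Set Function Metric Literature.Geometry.Lorentzian
  Summit.FinalStateConjecture.FinalStateConjecture.Theorems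

/-- A slice term `(v⁰) • X` is bounded by `‖v‖ ‖X‖` (`|v⁰| ≤ ‖v‖`). [folklore] -/
private theorem higherOrder_norm_coordZero_smul_le {F : Type*} [SeminormedAddCommGroup F] [NormedSpace ℝ F]
    (v : E4) (X : F) : ‖(v 0) • X‖ ≤ ‖v‖ * ‖X‖ := by
  rw [norm_smul, Real.norm_eq_abs]
  exact mul_le_mul_of_nonneg_right (higherOrder_absTime_EF v) (norm_nonneg X)

/-- A slice term `(v⁰ w⁰) • X` is bounded by `‖v‖ ‖w‖ ‖X‖`. [folklore] -/
private theorem higherOrder_norm_coordZero₂_smul_le {F : Type*} [SeminormedAddCommGroup F] [NormedSpace ℝ F]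
    (v w : E4) (X : F) : ‖(v 0 * w 0) • X‖ ≤ ‖v‖ * ‖w‖ * ‖X‖ := by
  rw [norm_smul, Real.norm_eq_abs, abs_mul]
  exact mul_le_mul_of_nonneg_right (mul_le_mul (higherOrder_absTime_EF v) (higherOrder_absTime_EF w)
    (abs_nonneg _) (norm_nonneg v)) (norm_nonneg X)

/-- A slice term `(y⁰ v⁰ w⁰) • X` is bounded by `‖y‖ ‖v‖ ‖w‖ ‖X‖`. [folklore] -/
theorem higherOrder_norm_coordZero₃_smul_le {F : Type*} [SeminormedAddCommGroup F] [NormedSpace ℝ F]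
    (y v w : E4) (X : F) : ‖(y 0 * v 0 * w 0) • X‖ ≤ ‖y‖ * ‖v‖ * ‖w‖ * ‖X‖ := by
  rw [norm_smul, Real.norm_eq_abs, abs_mul, abs_mul]
  refine mul_le_mul_of_nonneg_right ?_ (norm_nonneg X)
  exact mul_le_mul (mul_le_mul (higherOrder_absTime_EF y) (higherOrder_absTime_EF v) (abs_nonneg _)
    (norm_nonneg y)) (higherOrder_absTime_EF w) (abs_nonneg _) (by positivity)

/-- Operator norm of a bilinear jet from a bound on its values. [folklore] -/
private theorem higherOrder_opNorm₂_le_of_apply {F : Type*} [SeminormedAddCommGroup F] [NormedSpace ℝ F]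
    (T : E4 →L[ℝ] E4 →L[ℝ] F) {b : ℝ} (hb : 0 ≤ b) (h : ∀ v w, ‖T v w‖ ≤ b * ‖v‖ * ‖w‖) : ‖T‖ ≤ b :=
  ContinuousLinearMap.opNorm_le_bound _ hb fun v ↦
    ContinuousLinearMap.opNorm_le_bound _ (by positivity) fun w ↦ h v w

/-- Operator norm of a trilinear jet from a bound on its values. [folklore] -/
private theorem higherOrder_opNorm₃_le_of_apply {F : Type*} [SeminormedAddCommGroup F] [NormedSpace ℝ F]
    (T : E4 →L[ℝ] E4 →L[ℝ] E4 →L[ℝ] F) {b : ℝ} (hb : 0 ≤ b)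
    (h : ∀ y v w, ‖T y v w‖ ≤ b * ‖y‖ * ‖v‖ * ‖w‖) : ‖T‖ ≤ b :=
  ContinuousLinearMap.opNorm_le_bound _ hb fun y ↦
    ContinuousLinearMap.opNorm_le_bound _ (by positivity) fun v ↦
      ContinuousLinearMap.opNorm_le_bound _ (by positivity) fun w ↦ h y v w

/-- Values of a bilinear jet through its operator norm. [folklore] -/
private theorem higherOrder_norm_apply₂_le_opNorm {F : Type*} [SeminormedAddCommGroup F] [NormedSpace ℝ F]
    (T : E4 →L[ℝ] E4 →L[ℝ] F) {b : ℝ} (hT : ‖T‖ ≤ b) (v w : E4) : ‖T v w‖ ≤ b * ‖v‖ * ‖w‖ :=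
  ((T v).le_opNorm w).trans (mul_le_mul_of_nonneg_right
    ((T.le_opNorm v).trans (mul_le_mul_of_nonneg_right hT (norm_nonneg v))) (norm_nonneg w))

/-- Values of a trilinear jet through its operator norm. [folklore] -/
private theorem higherOrder_norm_apply₃_le_opNorm {F : Type*} [SeminormedAddCommGroup F] [NormedSpace ℝ F]
    (T : E4 →L[ℝ] E4 →L[ℝ] E4 →L[ℝ] F) {b : ℝ} (hT : ‖T‖ ≤ b) (y v w : E4) :
    ‖T y v w‖ ≤ b * ‖y‖ * ‖v‖ * ‖w‖ :=
  higherOrder_norm_apply₂_le_opNorm (T y)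
    ((T.le_opNorm y).trans (mul_le_mul_of_nonneg_right hT (norm_nonneg y))) v w

set_option maxHeartbeats 1600000 in
/-- **Jet bookkeeping for the third-order step.** See the module docstring. [folklore] -/
theorem higherOrder_c3step_jets
    {D₁ B₁ K₁ P₁' P₂' : E4 →L[ℝ] (E4 →L[ℝ] E4 →L[ℝ] ℝ)}
    {D₂ B₂ K₂ P₁'' : E4 →L[ℝ] E4 →L[ℝ] (E4 →L[ℝ] E4 →L[ℝ] ℝ)}
    {D₃ B₃ K₃ E₃ : E4 →L[ℝ] E4 →L[ℝ] E4 →L[ℝ] (E4 →L[ℝ] E4 →L[ℝ] ℝ)}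
    {P₁x P₂x P₃x : E4 →L[ℝ] E4 →L[ℝ] ℝ}
    (h1 : ∀ v : E4, D₁ v = B₁ v + (v 0) • P₁x)
    (h2 : ∀ v w : E4, D₂ v w = B₂ v w + (v 0) • P₁' w + (w 0) • P₁' v + (v 0 * w 0) • P₂x)
    (h3 : ∀ y v w : E4, D₃ y v w = B₃ y v w +
      ((v 0) • P₁'' y w + (w 0) • P₁'' y v + (y 0) • P₁'' v w) +
      ((v 0 * w 0) • P₂' y + (y 0 * w 0) • P₂' v + (y 0 * v 0) • P₂' w) + (y 0 * v 0 * w 0) • P₃x)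
    (hE : ∀ y v w : E4, E₃ y v w = D₃ y v w - (y 0 * v 0 * w 0) • P₃x)
    {C β σ₁ σ₂ σ₃ : ℝ} (hC : 0 ≤ C) (hβ : 0 ≤ β) (hσ₁ : 0 ≤ σ₁) (hσ₂ : 0 ≤ σ₂) (hσ₃ : 0 ≤ σ₃)
    (hB1 : ‖B₁‖ ≤ C) (hB2 : ‖B₂‖ ≤ C) (hB3 : ‖B₃‖ ≤ C)
    (hK1 : ‖B₁ - K₁‖ ≤ β) (hK2 : ‖B₂ - K₂‖ ≤ β) (hK3 : ‖B₃ - K₃‖ ≤ β)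
    (hP1 : ‖P₁x‖ ≤ σ₁) (hP1' : ‖P₁'‖ ≤ σ₁) (hP1'' : ‖P₁''‖ ≤ σ₁)
    (hP2 : ‖P₂x‖ ≤ σ₂) (hP2' : ‖P₂'‖ ≤ σ₂) (hP3 : ‖P₃x‖ ≤ σ₃) :
    ‖D₁‖ ≤ C + σ₁ ∧ ‖D₂‖ ≤ C + 2 * σ₁ + σ₂ ∧ ‖D₃‖ ≤ C + 3 * σ₁ + 3 * σ₂ + σ₃ ∧
    ‖E₃‖ ≤ C + 3 * σ₁ + 3 * σ₂ ∧
    ‖K₁ - D₁‖ ≤ β + σ₁ ∧ ‖K₂ - D₂‖ ≤ β + 2 * σ₁ + σ₂ ∧ ‖K₃ - E₃‖ ≤ β + 3 * σ₁ + 3 * σ₂ := by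
  -- termwise bounds
  have hv := fun v : E4 ↦ norm_nonneg v
  have t1 : ∀ v : E4, ‖(v 0) • P₁x‖ ≤ σ₁ * ‖v‖ := fun v ↦
    (higherOrder_norm_coordZero_smul_le v P₁x).trans (by
      rw [mul_comm]; exact mul_le_mul_of_nonneg_right hP1 (hv v))
  have t1' : ∀ v w : E4, ‖(v 0) • P₁' w‖ ≤ σ₁ * ‖v‖ * ‖w‖ := fun v w ↦
    (higherOrder_norm_coordZero_smul_le v (P₁' w)).trans
      ((mul_le_mul_of_nonneg_left ((P₁'.le_opNorm w).trans (mul_le_mul_of_nonneg_right hP1' (hv w)))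
        (hv v)).trans (le_of_eq (by ring)))
  have t1'' : ∀ u v w : E4, ‖(u 0) • P₁'' v w‖ ≤ σ₁ * ‖u‖ * ‖v‖ * ‖w‖ := fun u v w ↦
    (higherOrder_norm_coordZero_smul_le u (P₁'' v w)).trans
      ((mul_le_mul_of_nonneg_left (higherOrder_norm_apply₂_le_opNorm P₁'' hP1'' v w) (hv u)).trans
        (le_of_eq (by ring)))
  have t2 : ∀ v w : E4, ‖(v 0 * w 0) • P₂x‖ ≤ σ₂ * ‖v‖ * ‖w‖ := fun v w ↦
    (higherOrder_norm_coordZero₂_smul_le v w P₂x).trans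
      ((mul_le_mul_of_nonneg_left hP2 (mul_nonneg (hv v) (hv w))).trans (le_of_eq (by ring)))
  have t2' : ∀ u v w : E4, ‖(u 0 * v 0) • P₂' w‖ ≤ σ₂ * ‖u‖ * ‖v‖ * ‖w‖ := fun u v w ↦
    (higherOrder_norm_coordZero₂_smul_le u v (P₂' w)).trans
      ((mul_le_mul_of_nonneg_left ((P₂'.le_opNorm w).trans (mul_le_mul_of_nonneg_right hP2' (hv w)))
        (mul_nonneg (hv u) (hv v))).trans (le_of_eq (by ring)))
  have t3 : ∀ y v w : E4, ‖(y 0 * v 0 * w 0) • P₃x‖ ≤ σ₃ * ‖y‖ * ‖v‖ * ‖w‖ := fun y v w ↦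
    (higherOrder_norm_coordZero₃_smul_le y v w P₃x).trans
      ((mul_le_mul_of_nonneg_left hP3 (mul_nonneg (mul_nonneg (hv y) (hv v)) (hv w))).trans
        (le_of_eq (by ring)))
  refine ⟨?_, ?_, ?_, ?_, ?_, ?_, ?_⟩
  · refine ContinuousLinearMap.opNorm_le_bound _ (by positivity) fun v ↦ ?_
    rw [h1 v]
    have hb : ‖B₁ v‖ ≤ C * ‖v‖ := (B₁.le_opNorm v).trans (mul_le_mul_of_nonneg_right hB1 (hv v))
    calc ‖B₁ v + (v 0) • P₁x‖ ≤ ‖B₁ v‖ + ‖(v 0) • P₁x‖ := norm_add_le _ _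
      _ ≤ C * ‖v‖ + σ₁ * ‖v‖ := add_le_add hb (t1 v)
      _ = (C + σ₁) * ‖v‖ := by ring
  · refine higherOrder_opNorm₂_le_of_apply _ (by positivity) fun v w ↦ ?_
    rw [h2 v w]
    have hb : ‖B₂ v w‖ ≤ C * ‖v‖ * ‖w‖ := higherOrder_norm_apply₂_le_opNorm B₂ hB2 v w
    have k1 := t1' v w
    have k2 : ‖(w 0) • P₁' v‖ ≤ σ₁ * ‖v‖ * ‖w‖ := (t1' w v).trans (le_of_eq (by ring))
    have k3 := t2 v w
    calc _ ≤ ‖B₂ v w + (v 0) • P₁' w + (w 0) • P₁' v‖ + ‖(v 0 * w 0) • P₂x‖ := norm_add_le _ _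
      _ ≤ ‖B₂ v w‖ + ‖(v 0) • P₁' w‖ + ‖(w 0) • P₁' v‖ + ‖(v 0 * w 0) • P₂x‖ :=
          add_le_add norm_add₃_le le_rfl
      _ ≤ _ := by linarith only [hb, k1, k2, k3]
  · refine higherOrder_opNorm₃_le_of_apply _ (by positivity) fun y v w ↦ ?_
    rw [h3 y v w]
    have hb : ‖B₃ y v w‖ ≤ C * ‖y‖ * ‖v‖ * ‖w‖ := higherOrder_norm_apply₃_le_opNorm B₃ hB3 y v w
    have k1 : ‖(v 0) • P₁'' y w‖ ≤ σ₁ * ‖y‖ * ‖v‖ * ‖w‖ := (t1'' v y w).trans (le_of_eq (by ring))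
    have k2 : ‖(w 0) • P₁'' y v‖ ≤ σ₁ * ‖y‖ * ‖v‖ * ‖w‖ := (t1'' w y v).trans (le_of_eq (by ring))
    have k3 : ‖(y 0) • P₁'' v w‖ ≤ σ₁ * ‖y‖ * ‖v‖ * ‖w‖ := t1'' y v w
    have k4 : ‖(v 0 * w 0) • P₂' y‖ ≤ σ₂ * ‖y‖ * ‖v‖ * ‖w‖ := (t2' v w y).trans (le_of_eq (by ring))
    have k5 : ‖(y 0 * w 0) • P₂' v‖ ≤ σ₂ * ‖y‖ * ‖v‖ * ‖w‖ := (t2' y w v).trans (le_of_eq (by ring))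
    have k6 : ‖(y 0 * v 0) • P₂' w‖ ≤ σ₂ * ‖y‖ * ‖v‖ * ‖w‖ := t2' y v w
    have k7 := t3 y v w
    calc _ ≤ ‖B₃ y v w + ((v 0) • P₁'' y w + (w 0) • P₁'' y v + (y 0) • P₁'' v w) +
          ((v 0 * w 0) • P₂' y + (y 0 * w 0) • P₂' v + (y 0 * v 0) • P₂' w)‖ +
          ‖(y 0 * v 0 * w 0) • P₃x‖ := norm_add_le _ _
      _ ≤ ‖B₃ y v w‖ + ‖(v 0) • P₁'' y w + (w 0) • P₁'' y v + (y 0) • P₁'' v w‖ +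
          ‖(v 0 * w 0) • P₂' y + (y 0 * w 0) • P₂' v + (y 0 * v 0) • P₂' w‖ +
          ‖(y 0 * v 0 * w 0) • P₃x‖ := add_le_add norm_add₃_le le_rfl
      _ ≤ ‖B₃ y v w‖ + (‖(v 0) • P₁'' y w‖ + ‖(w 0) • P₁'' y v‖ + ‖(y 0) • P₁'' v w‖) +
          (‖(v 0 * w 0) • P₂' y‖ + ‖(y 0 * w 0) • P₂' v‖ + ‖(y 0 * v 0) • P₂' w‖) +
          ‖(y 0 * v 0 * w 0) • P₃x‖ :=
          add_le_add (add_le_add (add_le_add le_rfl norm_add₃_le) norm_add₃_le) le_rfl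
      _ ≤ _ := by linarith only [hb, k1, k2, k3, k4, k5, k6, k7]
  · refine higherOrder_opNorm₃_le_of_apply _ (by positivity) fun y v w ↦ ?_
    rw [hE y v w, h3 y v w, add_sub_cancel_right]
    have hb : ‖B₃ y v w‖ ≤ C * ‖y‖ * ‖v‖ * ‖w‖ := higherOrder_norm_apply₃_le_opNorm B₃ hB3 y v w
    have k1 : ‖(v 0) • P₁'' y w‖ ≤ σ₁ * ‖y‖ * ‖v‖ * ‖w‖ := (t1'' v y w).trans (le_of_eq (by ring))
    have k2 : ‖(w 0) • P₁'' y v‖ ≤ σ₁ * ‖y‖ * ‖v‖ * ‖w‖ := (t1'' w y v).trans (le_of_eq (by ring))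
    have k3 : ‖(y 0) • P₁'' v w‖ ≤ σ₁ * ‖y‖ * ‖v‖ * ‖w‖ := t1'' y v w
    have k4 : ‖(v 0 * w 0) • P₂' y‖ ≤ σ₂ * ‖y‖ * ‖v‖ * ‖w‖ := (t2' v w y).trans (le_of_eq (by ring))
    have k5 : ‖(y 0 * w 0) • P₂' v‖ ≤ σ₂ * ‖y‖ * ‖v‖ * ‖w‖ := (t2' y w v).trans (le_of_eq (by ring))
    have k6 : ‖(y 0 * v 0) • P₂' w‖ ≤ σ₂ * ‖y‖ * ‖v‖ * ‖w‖ := t2' y v w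
    calc _ ≤ ‖B₃ y v w + ((v 0) • P₁'' y w + (w 0) • P₁'' y v + (y 0) • P₁'' v w)‖ +
          ‖(v 0 * w 0) • P₂' y + (y 0 * w 0) • P₂' v + (y 0 * v 0) • P₂' w‖ := norm_add_le _ _
      _ ≤ ‖B₃ y v w‖ + ‖(v 0) • P₁'' y w + (w 0) • P₁'' y v + (y 0) • P₁'' v w‖ +
          ‖(v 0 * w 0) • P₂' y + (y 0 * w 0) • P₂' v + (y 0 * v 0) • P₂' w‖ :=
          add_le_add (norm_add_le _ _) le_rfl
      _ ≤ ‖B₃ y v w‖ + (‖(v 0) • P₁'' y w‖ + ‖(w 0) • P₁'' y v‖ + ‖(y 0) • P₁'' v w‖) +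
          (‖(v 0 * w 0) • P₂' y‖ + ‖(y 0 * w 0) • P₂' v‖ + ‖(y 0 * v 0) • P₂' w‖) :=
          add_le_add (add_le_add le_rfl norm_add₃_le) norm_add₃_le
      _ ≤ _ := by linarith only [hb, k1, k2, k3, k4, k5, k6]
  · refine ContinuousLinearMap.opNorm_le_bound _ (by positivity) fun v ↦ ?_
    rw [_root_.sub_apply, h1 v]
    have e : K₁ v - (B₁ v + (v 0) • P₁x) = -((B₁ - K₁) v) - (v 0) • P₁x := by
      rw [_root_.sub_apply]; abel
    rw [e]
    have hb : ‖-((B₁ - K₁) v)‖ ≤ β * ‖v‖ := by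
      rw [norm_neg]; exact ((B₁ - K₁).le_opNorm v).trans (mul_le_mul_of_nonneg_right hK1 (hv v))
    calc ‖-((B₁ - K₁) v) - (v 0) • P₁x‖ ≤ ‖-((B₁ - K₁) v)‖ + ‖(v 0) • P₁x‖ := norm_sub_le _ _
      _ ≤ β * ‖v‖ + σ₁ * ‖v‖ := add_le_add hb (t1 v)
      _ = (β + σ₁) * ‖v‖ := by ring
  · refine higherOrder_opNorm₂_le_of_apply _ (by positivity) fun v w ↦ ?_
    rw [_root_.sub_apply, _root_.sub_apply, h2 v w]
    have e : K₂ v w - (B₂ v w + (v 0) • P₁' w + (w 0) • P₁' v + (v 0 * w 0) • P₂x) =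
        -((B₂ - K₂) v w) - ((v 0) • P₁' w + (w 0) • P₁' v + (v 0 * w 0) • P₂x) := by
      rw [_root_.sub_apply, _root_.sub_apply]; abel
    rw [e]
    have hb : ‖-((B₂ - K₂) v w)‖ ≤ β * ‖v‖ * ‖w‖ := by
      rw [norm_neg]; exact higherOrder_norm_apply₂_le_opNorm _ hK2 v w
    have k1 := t1' v w
    have k2 : ‖(w 0) • P₁' v‖ ≤ σ₁ * ‖v‖ * ‖w‖ := (t1' w v).trans (le_of_eq (by ring))
    have k3 := t2 v w
    calc _ ≤ ‖-((B₂ - K₂) v w)‖ + ‖(v 0) • P₁' w + (w 0) • P₁' v + (v 0 * w 0) • P₂x‖ := norm_sub_le _ _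
      _ ≤ ‖-((B₂ - K₂) v w)‖ + (‖(v 0) • P₁' w‖ + ‖(w 0) • P₁' v‖ + ‖(v 0 * w 0) • P₂x‖) :=
          add_le_add le_rfl norm_add₃_le
      _ ≤ _ := by linarith only [hb, k1, k2, k3]
  · refine higherOrder_opNorm₃_le_of_apply _ (by positivity) fun y v w ↦ ?_
    rw [_root_.sub_apply, _root_.sub_apply, _root_.sub_apply,
      hE y v w, h3 y v w, add_sub_cancel_right]
    have e : K₃ y v w - (B₃ y v w + ((v 0) • P₁'' y w + (w 0) • P₁'' y v + (y 0) • P₁'' v w) +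
        ((v 0 * w 0) • P₂' y + (y 0 * w 0) • P₂' v + (y 0 * v 0) • P₂' w)) =
        -((B₃ - K₃) y v w) - (((v 0) • P₁'' y w + (w 0) • P₁'' y v + (y 0) • P₁'' v w) +
        ((v 0 * w 0) • P₂' y + (y 0 * w 0) • P₂' v + (y 0 * v 0) • P₂' w)) := by
      rw [_root_.sub_apply, _root_.sub_apply, _root_.sub_apply]; abel
    rw [e]
    have hb : ‖-((B₃ - K₃) y v w)‖ ≤ β * ‖y‖ * ‖v‖ * ‖w‖ := by
      rw [norm_neg]; exact higherOrder_norm_apply₃_le_opNorm _ hK3 y v w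
    have k1 : ‖(v 0) • P₁'' y w‖ ≤ σ₁ * ‖y‖ * ‖v‖ * ‖w‖ := (t1'' v y w).trans (le_of_eq (by ring))
    have k2 : ‖(w 0) • P₁'' y v‖ ≤ σ₁ * ‖y‖ * ‖v‖ * ‖w‖ := (t1'' w y v).trans (le_of_eq (by ring))
    have k3 : ‖(y 0) • P₁'' v w‖ ≤ σ₁ * ‖y‖ * ‖v‖ * ‖w‖ := t1'' y v w
    have k4 : ‖(v 0 * w 0) • P₂' y‖ ≤ σ₂ * ‖y‖ * ‖v‖ * ‖w‖ := (t2' v w y).trans (le_of_eq (by ring))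
    have k5 : ‖(y 0 * w 0) • P₂' v‖ ≤ σ₂ * ‖y‖ * ‖v‖ * ‖w‖ := (t2' y w v).trans (le_of_eq (by ring))
    have k6 : ‖(y 0 * v 0) • P₂' w‖ ≤ σ₂ * ‖y‖ * ‖v‖ * ‖w‖ := t2' y v w
    calc _ ≤ ‖-((B₃ - K₃) y v w)‖ + ‖((v 0) • P₁'' y w + (w 0) • P₁'' y v + (y 0) • P₁'' v w) +
          ((v 0 * w 0) • P₂' y + (y 0 * w 0) • P₂' v + (y 0 * v 0) • P₂' w)‖ := norm_sub_le _ _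
      _ ≤ ‖-((B₃ - K₃) y v w)‖ + ((‖(v 0) • P₁'' y w‖ + ‖(w 0) • P₁'' y v‖ + ‖(y 0) • P₁'' v w‖) +
          (‖(v 0 * w 0) • P₂' y‖ + ‖(y 0 * w 0) • P₂' v‖ + ‖(y 0 * v 0) • P₂' w‖)) :=
          add_le_add le_rfl ((norm_add_le _ _).trans (add_le_add norm_add₃_le norm_add₃_le))
      _ ≤ _ := by linarith only [hb, k1, k2, k3, k4, k5, k6]

/-- **Registered one-line carrier form** (`higherOrder_c3jets_EF`) of
`higherOrder_norm_coordZero₃_smul_le`. [folklore] -/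
theorem higherOrder_c3jets_EF : open Literature.Geometry.Lorentzian in ∀ (y v w : E4) (X : E4 →L[ℝ] E4 →L[ℝ] ℝ), ‖(y 0 * v 0 * w 0) • X‖ ≤ ‖y‖ * ‖v‖ * ‖w‖ * ‖X‖ :=
  fun y v w X ↦ higherOrder_norm_coordZero₃_smul_le y v w X

end Summit.FinalStateConjecture.FinalStateConjecture.Theorems.SublinearIsFree.Slaving

end
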